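import Summits.CriticalPhenomena.PercolationContinuityZ3.Theorems.FK.Transplant.KNFreeRunCover
import Summits.CriticalPhenomena.PercolationContinuityZ3.Theorems.FK.Transplant.KNFreePinningLawFK
import HarnessLib

/-!
# FK-continuity transplant, FT-07 (c): (32)-FK along the run — every history of the FK exploration process at
# which a macro-edge is chosen is FK-valid (region/history monotonicity, refuter F4 (c))

Cell `fk-continuity` (bschramm), FRONTIER TRANSPLANT sub-cell, row FT-07 (`KNFreeTheorem6`, part c); support file
(`--supports stmt-CriticalPhenomena-4575`); builds on p205010 (kernel theorem, internal audit signed; external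
expert review pending). HONEST FRAMING: the transplant this file serves is CONDITIONAL on the free-boundary
penetration hypothesis FH (open at the same `p` for `q > 1`; ⇔ GRC Conj. (5.103) via K1; barrier note
`Literature.Barriers.CriticalPhenomena.SamePFreeBoundaryCriteria`); a typed reduction, not a proof of FK continuity.
THIS file is unconditional: no named facts, no sorries, standard axioms; `FH` does not occur in it.

## What is here

Kozma–Nitzan, arXiv:2401.12397 §4 p. 28, the estimate (32) along the run: at `q = 1` (tree `KSch.reach_of_probe`,
`KSch.reach_zero`) the declaration-time law of (30) and the use-time law of (32) AGREE on the relevant event by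
product structure ("the additional information is irrelevant"); under the random-cluster law they are COMPARED
(REFUTER-REPORT §8 F4 (c), region/history monotonicity): by (31) (FT-07 (b) `RunFK.mem_Stub_of_mem_V_of_mem_Efar`)
nothing revealed between declaration and use lies inside the declaration region `Sx` except what was pinned at
declaration, so the declaration weighting `Wt` is pointwise BELOW the use-time weighting `W₀` (equal on `Sx`, zero
off it); the law on `Sx` is the law on the larger use-time piece (fkt-p3's `fkLaw_eq_of_subset`, `KNFreeLawSupport.lean`), and
weight-monotonicity (M) of the pinning law `fkLaw` (FT-06d `isPinningLaw_fkLaw`, `q ≥ 1`) raises the increasing event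
`{0 ↔ M_x}`:

* `RunFK.Wt_le_W₀` — the pointwise comparison; `RunFK.reach_of_probe` — **(32)-FK for `w ≠ 0`**;
* `RunFK.hitW₀_le_W₀`, `RunFK.reach_zero` — **(32)-FK for `w = 0`** from `OriginFK` (FT-01);
* `RunFK.validFK_of_choice` — **every history of the FK run at which an edge is chosen is `ValidFK`**.

## References

* G. Kozma, S. Nitzan, arXiv:2401.12397 (2024), §4 p. 28 ((32), Step I), p. 27 ((31)). [KozmaNitzan2024]
* G. Grimmett, *The Random-Cluster Model*, Springer 2006: eq. (3.22), Lemma (4.13). [Grimmett2006]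
-/

noncomputable section

open MeasureTheory
open scoped ENNReal Classical

namespace Summit.CriticalPhenomena.PercolationContinuityZ3.Theorems.FK

open Literature.Probability.Percolation Literature.Probability.LatticeModels SimpleGraph
open Literature.Probability.Percolation.GadgetSystem Literature.Probability.Percolation.KozmaNitzan
open ProbeHistory HSiteScheme KSch Cells Transplant

variable {d : ℕ}

namespace RunFK

variable {S : KSch d} {q : ℝ} {ω : BondConfig (Site d)}

/-- **The declaration weighting lies below the use-time weighting** ((31) ⇒ refuter F4 (c)): let `e` be the
macro-edge examined at time `m`, `v = tgt e`, and let `x = v + du` be still undetermined at time `n > m`; then the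
weighting `Wt` of (30) at the declared level `j_x` is pointwise `≤` the weighting `W₀` of (32) for the edge `(v, du)`
after `n` steps: on the pairs of `Sx_m = E_m ∪ E_{w,v} ∪ E_{v,x}` the two pinnings agree (nothing else was revealed
there, (31)), and off `Sx_m` the declaration weighting vanishes. [cite: KozmaNitzan2024, §4 p. 28 ((32)), p. 27 ((31))] -/
theorem Wt_le_W₀ {n m : ℕ} (hm : m < n) {e : Site 2 × MDir}
    (hc : ((schemeFK S q).stN m ω).choice = some e) (hV : ValidFK S q (hst S q ω m) e)
    (hD : (schemeFK S q).E.next (hst S q ω m) = some (probeFK S q (hst S q ω m) e)) {du : MDir}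
    (hv : ¬((schemeFK S q).stN n ω).Det (tgt e + stepVec du)) (x : Sym2 (Site d)) :
    S.Wt (hst S q ω m) e du (jOfFK S q (hst S q ω m) e du (obs ω (S.env (hst S q ω m) e)))
        (obs ω (S.env (hst S q ω m) e)) x ≤
      S.W₀ (hst S q ω n) (tgt e, du) x := by
  set hm_ := hst S q ω m with hhm
  set o := obs ω (S.env hm_ e) with ho
  set j := jOfFK S q hm_ e du o with hjdef
  have hI := runInv S q ω n
  have hIm := runInv S q ω m
  have hdu : du ∈ S.onward hm_ (tgt e) := mem_onward_of_not_det hm.le hv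
  have hjK : j < S.C.K := jOfFK_lt S q _ _ _ _
  -- `Fj_m ⊆ F_n`
  have hF1 : S.F (hst S q ω (m + 1)) = S.F hm_ ∪ revealOfFK S q hm_ e o := (step_some S q hc hD).1
  have hFjF : S.Fj hm_ e du j ⊆ S.F (hst S q ω n) := by
    intro y hy
    by_cases hyF : y ∈ S.F hm_
    · exact F_mono S q ω hm.le hyF
    · have h1 : y ∈ revealOfFK S q hm_ e o := Fj_sdiff_subset_revealOfFK S q hdu le_rfl (Finset.mem_sdiff.2 ⟨hy, hyF⟩)
      refine F_mono S q ω (Nat.succ_le_of_lt hm) ?_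
      show y ∈ S.F (hst S q ω (m + 1))
      rw [hF1]; exact Finset.mem_union_right _ h1
  -- `F_n ∩ wireSet(Sx_m) ⊆ Fj_m` ((31))
  have hkey : ∀ y ∈ S.F (hst S q ω n), y ∈ wireSet (↑(S.Sx hm_ e du) : Set (Site d)) → y ∈ S.Fj hm_ e du j := by
    intro y hy hyS
    rw [hI.F_eq, mem_edgesIn_iff] at hy
    rw [KSch.Fj, mem_edgesIn_iff]
    refine ⟨hy.1, fun z hz => ?_⟩
    have hzV := hy.2 z hz
    have hzS := Finset.mem_coe.1 (hyS.1 z hz)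
    rcases Finset.mem_union.1 hzS with hzS | hzS
    · exact Finset.mem_union_left _ hzS
    · exact Finset.mem_union_right _ (mem_Stub_of_mem_V_of_mem_Efar hm hc hV hD hv hzV hzS)
  -- `Sx_m ⊆ E_n ∪ E_{v,x}`
  have hSx : (↑(S.Sx hm_ e du) : Set (Site d)) ⊆ ↑(S.V (hst S q ω n) ∪ S.C.Ewv (tgt e) du) := by
    refine Finset.coe_subset.2 fun y hy => ?_
    rcases Finset.mem_union.1 hy with hy | hy
    · rcases Finset.mem_union.1 hy with hy | hy
      · exact Finset.mem_union_left _ (V_mono S q ω hm.le hy)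
      · exact Finset.mem_union_left _ (newRegion_subset_V hm hc hD (Finset.mem_union_left _ hy))
    · exact Finset.mem_union_right _ (S.C.Efar_subset_Ewv _ _ hy)
  unfold KSch.Wt KSch.W₀
  by_cases hxS : x ∈ wireSet (↑(S.Sx hm_ e du) : Set (Site d))
  · rw [restrW_apply_of_mem _ hxS, restrW_apply_of_mem _ (KozmaNitzan.wireSet_mono hSx hxS)]
    refine le_of_eq ?_
    by_cases hxj : x ∈ S.Fj hm_ e du j
    · refine KSch.pinW_apply_eq_of_mem _ (Finset.mem_coe.2 hxj) (Finset.mem_coe.2 (hFjF hxj)) ?_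
      rw [Finset.mem_coe, KSch.pat, Finset.mem_union, Finset.mem_inter, Finset.mem_sdiff, ho, mem_obs_iff,
        Finset.mem_coe, hI.ξ_iff x]
      by_cases hxF : x ∈ S.F hm_
      · rw [hIm.ξ_iff x]
        constructor
        · rintro (⟨-, h'⟩ | ⟨-, -, h'⟩)
          · exact ⟨hFjF hxj, h'⟩
          · exact absurd hxF h'
        · rintro ⟨-, h'⟩; exact Or.inl ⟨hxF, h'⟩
      · have hxenv : x ∈ S.env hm_ e := S.Fj_sdiff_subset_env hm_ e hdu hjK (Finset.mem_sdiff.2 ⟨hxj, hxF⟩)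
        have hxU : x ∉ S.U₀ := fun h' => hxF (S.U₀_subset_F _ h')
        constructor
        · rintro (h' | ⟨⟨-, h'⟩, -, -⟩)
          · exact absurd (hV.ξ_sub h') hxF
          · exact ⟨hFjF hxj, Or.inl h'⟩
        · rintro ⟨-, h' | h'⟩
          · exact Or.inr ⟨⟨hxenv, h'⟩, hxj, hxF⟩
          · exact absurd h' hxU
    · have hxF : x ∉ S.F (hst S q ω n) := fun h' => hxj (hkey x h' hxS)
      rw [pinW_apply_of_not_mem _ _ (fun h' => hxj (Finset.mem_coe.1 h')),
        pinW_apply_of_not_mem _ _ (fun h' => hxF (Finset.mem_coe.1 h'))]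
  · rw [restrW_apply_of_not_mem _ hxS]
    exact bot_le

/-- **(32)-FK for `w ≠ 0`** (KN p. 28 and Step I, under the random-cluster law): if `w` was examined at time
`m < n` and its connection to the still undetermined `x = v + du` was good at level `j_x` under the minimal law
(FT-01 `condFK`), then the FK-validity estimate holds at time `n` for the edge `(v, du)`:
`(fkLaw (E_n ∪ E_{v,x}) (W₀) q)(0 ↔ M_x) > 1 - δ`. Support change `Sx_m → E_n ∪ E_{v,x}` and weight-monotonicity
(`Wt_le_W₀`, (M) for `q ≥ 1`) replace the `q = 1` identities. [cite: KozmaNitzan2024, §4 p. 28 ((32) for w ≠ 0); Grimmett2006, eq. (3.22)] -/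
theorem reach_of_probe (hq : 1 ≤ q) {n m : ℕ} (hm : m < n) {e : Site 2 × MDir}
    (hc : ((schemeFK S q).stN m ω).choice = some e) (hV : ValidFK S q (hst S q ω m) e)
    (hD : (schemeFK S q).E.next (hst S q ω m) = some (probeFK S q (hst S q ω m) e)) {du : MDir}
    (hv : ¬((schemeFK S q).stN n ω).Det (tgt e + stepVec du))
    (hcond : condFK S q (hst S q ω m) e du (jOfFK S q (hst S q ω m) e du (obs ω (S.env (hst S q ω m) e)))
      (obs ω (S.env (hst S q ω m) e))) :
    1 - S.δc < (fkLaw (S.V (hst S q ω n) ∪ S.C.Ewv (tgt e) du) (S.W₀ (hst S q ω n) (tgt e, du)) q).real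
      (⋃ t ∈ S.C.M (tgt (tgt e, du)), openConn (0 : Site d) t) := by
  have hq0 : 0 < q := one_pos.trans_le hq
  set hm_ := hst S q ω m with hhm
  set o := obs ω (S.env hm_ e) with ho
  set j := jOfFK S q hm_ e du o with hjdef
  set Λ' : Finset (Site d) := S.V (hst S q ω n) ∪ S.C.Ewv (tgt e) du with hΛ'
  -- `Sx_m ⊆ Λ'`
  have hSx : S.Sx hm_ e du ⊆ Λ' := by
    intro y hy
    rcases Finset.mem_union.1 hy with hy | hy
    · rcases Finset.mem_union.1 hy with hy | hy
      · exact Finset.mem_union_left _ (V_mono S q ω hm.le hy)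
      · exact Finset.mem_union_left _ (newRegion_subset_V hm hc hD (Finset.mem_union_left _ hy))
    · exact Finset.mem_union_right _ (S.C.Efar_subset_Ewv _ _ hy)
  have hWt0 : FinSupp (S.Wt hm_ e du j o) (S.Sx hm_ e du) := finSupp_restrW _ _
  have hc' : 1 - S.δc < (fkLaw Λ' (S.Wt hm_ e du j o) q).real (S.Conn e du) := by
    rw [fkLaw_eq_of_subset hSx hWt0 hq0]
    exact hcond
  have hmono := (isPinningLaw_fkLaw Λ' hq).mono (S.Wt hm_ e du j o) (S.W₀ (hst S q ω n) (tgt e, du))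
    (fun x _ => Wt_le_W₀ hm hc hV hD hv x) (S.Conn e du) (isUpperSet_biUnion_openConn _ _)
    (measurableSet_biUnion_openConn _ _)
  exact lt_of_lt_of_le hc' hmono

/-- **The origin weighting lies below the use-time weighting** (KN p. 28: `(E₁ ∪ E_{0,v}) ∩ E_n = E₁` as long as
`v` is undetermined, FT-07 (b) `RunFK.not_mem_Ewv_zero_of_mem_V`): the free-look weighting of `Q_0 ∪ E_{0,v}` with
`U₀` pinned open is pointwise `≤` the weighting `W₀` of (32) for the edge `(0, du)` after `n` steps.
[cite: KozmaNitzan2024, §4 p. 28 ((32) for w = 0)] -/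
theorem hitW₀_le_W₀ {n : ℕ} {du : MDir} (hv : ¬((schemeFK S q).stN n ω).Det ((0 : Site 2) + stepVec du))
    (x : Sym2 (Site d)) :
    restrW (↑(S.C.Q 0 ∪ S.C.Ewv 0 du) : Set (Site d)) (pinW (lattW d S.p) ↑S.U₀ ↑S.U₀) x ≤
      S.W₀ (hst S q ω n) ((0 : Site 2), du) x := by
  have hI := runInv S q ω n
  have hQ0V : S.C.Q 0 ⊆ S.V (hst S q ω n) := hI.det_Q 0 (Or.inl (zero_mem_occ n))
  have hsub : (↑(S.C.Q 0 ∪ S.C.Ewv 0 du) : Set (Site d)) ⊆ ↑(S.V (hst S q ω n) ∪ S.C.Ewv 0 du) :=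
    Finset.coe_subset.2 (Finset.union_subset_union hQ0V le_rfl)
  -- `F_n ∩ wireSet(Q_0 ∪ E_{0,v}) ⊆ U₀`
  have hkey : ∀ y ∈ S.F (hst S q ω n), y ∈ wireSet (↑(S.C.Q 0 ∪ S.C.Ewv 0 du) : Set (Site d)) → y ∈ S.U₀ := by
    intro y hy hyS
    rw [hI.F_eq, mem_edgesIn_iff] at hy
    rw [KSch.U₀, mem_edgesIn_iff]
    refine ⟨hy.1, fun z hz => ?_⟩
    rcases Finset.mem_union.1 (Finset.mem_coe.1 (hyS.1 z hz)) with h | h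
    · exact h
    · exact absurd h (not_mem_Ewv_zero_of_mem_V hv (hy.2 z hz))
  unfold KSch.W₀
  by_cases hxS : x ∈ wireSet (↑(S.C.Q 0 ∪ S.C.Ewv 0 du) : Set (Site d))
  · rw [restrW_apply_of_mem _ hxS, restrW_apply_of_mem _ (KozmaNitzan.wireSet_mono hsub hxS)]
    refine le_of_eq ?_
    by_cases hxF : x ∈ S.F (hst S q ω n)
    · have hxU : x ∈ S.U₀ := hkey x hxF hxS
      refine KSch.pinW_apply_eq_of_mem _ (Finset.mem_coe.2 hxU) (Finset.mem_coe.2 hxF) ?_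
      rw [Finset.mem_coe, Finset.mem_coe, hI.ξ_iff x]
      exact ⟨fun h => ⟨hxF, Or.inr h⟩, fun _ => hxU⟩
    · have hxU : x ∉ S.U₀ := fun h' => hxF (S.U₀_subset_F _ h')
      rw [pinW_apply_of_not_mem _ _ (fun h' => hxU (Finset.mem_coe.1 h')),
        pinW_apply_of_not_mem _ _ (fun h' => hxF (Finset.mem_coe.1 h'))]
  · rw [restrW_apply_of_not_mem _ hxS]
    exact bot_le

/-- **(32)-FK for `w = 0`** (KN p. 28): from (32)-FK at the origin (`OriginFK S q du`, FT-01; supplied by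
binder h_orig) — the cube `Q_0` is wired open, and as long as `v = 0 + du` is undetermined the explored region avoids
`E_{0,v}`, so the origin weighting lies below `W₀` (`hitW₀_le_W₀`); support change and (M) as in `reach_of_probe`.
[cite: KozmaNitzan2024, §4 p. 28 ((32) for w = 0); Grimmett2006, eq. (3.22)] -/
theorem reach_zero (hq : 1 ≤ q) {n : ℕ} {du : MDir} (hv : ¬((schemeFK S q).stN n ω).Det ((0 : Site 2) + stepVec du))
    (hQ0 : OriginFK S q du) :
    1 - S.δc < (fkLaw (S.V (hst S q ω n) ∪ S.C.Ewv 0 du) (S.W₀ (hst S q ω n) ((0 : Site 2), du)) q).real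
      (⋃ t ∈ S.C.M (tgt ((0 : Site 2), du)), openConn (0 : Site d) t) := by
  have hq0 : 0 < q := one_pos.trans_le hq
  have hI := runInv S q ω n
  have hQ0V : S.C.Q 0 ⊆ S.V (hst S q ω n) := hI.det_Q 0 (Or.inl (zero_mem_occ n))
  set Λ0 : Finset (Site d) := S.C.Q 0 ∪ S.C.Ewv 0 du with hΛ0
  set Λ' : Finset (Site d) := S.V (hst S q ω n) ∪ S.C.Ewv 0 du with hΛ'
  set W' := restrW (↑Λ0 : Set (Site d)) (pinW (lattW d S.p) ↑S.U₀ ↑S.U₀) with hW'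
  have hsub : Λ0 ⊆ Λ' := Finset.union_subset_union hQ0V le_rfl
  have hW'0 : FinSupp W' Λ0 := finSupp_restrW _ _
  haveI := (isPinningLaw_fkLaw Λ0 hq).prob W'
  -- `OriginFK` read with `openConn ⊇ openConnIn`, then on `Λ'`, then under `W₀`
  have h1 : 1 - S.δc < (fkLaw Λ0 W' q).real (⋃ t ∈ S.C.M ((0 : Site 2) + stepVec du), openConn (0 : Site d) t) := by
    refine lt_of_lt_of_le hQ0 (measureReal_mono ?_ (measure_ne_top _ _))
    rw [← Finset.set_biUnion_coe]
    exact biUnion_openConnIn_subset_biUnion_openConn _ _ _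
  rw [← fkLaw_eq_of_subset hsub hW'0 hq0] at h1
  exact lt_of_lt_of_le h1 ((isPinningLaw_fkLaw Λ' hq).mono W' (S.W₀ (hst S q ω n) ((0 : Site 2), du))
    (fun x _ => hitW₀_le_W₀ hv x) _ (isUpperSet_biUnion_openConn _ _) (measurableSet_biUnion_openConn _ _))

/-- **Every history of the FK run at which an edge is chosen is FK-valid** ((29), the cover property and (32)-FK;
tree `KSch.valid_of_choice` with the law swapped): given (32)-FK at the origin in every direction (`OriginFK`,
binder h_orig). [cite: KozmaNitzan2024, §4 pp. 26–28 ((29), (31), (32))] -/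
theorem validFK_of_choice (hq : 1 ≤ q) (hQ0 : ∀ du : MDir, OriginFK S q du)
    {n : ℕ} {e : Site 2 × MDir} (hc : ((schemeFK S q).stN n ω).choice = some e) : ValidFK S q (hst S q ω n) e := by
  have hI := runInv S q ω n
  obtain ⟨he1, he2⟩ := HState.cand_of_choice hc
  refine ⟨hI.F_eq, fun x hx => ((hI.ξ_iff x).1 hx).1, zero_mem_V n, cen_mem_V_of_det (Or.inl he1), ?_, ?_⟩
  · refine ⟨{x | ((schemeFK S q).stN n ω).Det x}, he2, fun du hdu hdet => ?_, V_subset_Cover n⟩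
    exact (Finset.mem_filter.1 hdu).2 (cen_mem_V_of_det hdet)
  · obtain ⟨w, du⟩ := e
    rcases (schemeFK S q).exists_probe_of_det ω n w (Or.inl he1) with hw0 | ⟨m, hm, e₀, P, hc₀, ht₀, hP, hocc⟩
    · subst hw0
      exact reach_zero hq he2 (hQ0 du)
    · obtain ⟨e₁, hc₁, hV₀, rfl⟩ := of_next_some S q hP
      rw [hc₀] at hc₁
      cases Option.some_injective _ hc₁
      subst ht₀
      have hsucc : succFK S q (hst S q ω m) e₀ (obs ω (S.env (hst S q ω m) e₀)) :=
        (succFK_read_iff S q _ _ _).1 (hocc.1 he1)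
      have hdu : du ∈ S.onward (hst S q ω m) (tgt e₀) := mem_onward_of_not_det hm.le he2
      exact reach_of_probe hq hm hc₀ hV₀ hP he2 (hsucc du hdu)

end RunFK

end Summit.CriticalPhenomena.PercolationContinuityZ3.Theorems.FK

end
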